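import Summits.SmoothPoincare4.SmoothPoincare4.Theorems.AcyclicBisectionExists.Negative.OneSided
import Literature.Topology.FourManifolds.BordismFourProjectivePlane

/-!
# `AcyclicBisectionExists` — negative-side support (4/5): the seam is a ℚHS³ in both directions;
# `ℂℙ²` refutes the "closed simply connected" weakening

* §10 `Witness.finrank_homology_bd₂_three` (`dim H₃(∂W₂; ℚ) = 1`), `acyclic_of_seam`,
  `acyclic_iff_seam_of_homotopyEquiv`: over `M ≃ₕ S⁴` with connected halves, ℚ-acyclic ⇔ seam a
  ℚ-homology sphere in degrees 1, 2 (the crux text's "(⇔ seam a connected ℚHS³)").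
* §7 `not_hasAcyclicSteinBisection_complexProjectivePlane`,
  `not_acyclicBisectionExistsForSimplyConnectedClosed`: the hypothesis `M ≃ₕ S⁴` of the crux
  cannot be weakened to "`M` closed and simply connected" — `H₂(ℂℙ²; ℚ) ≅ ℚ` against
  `isZero_homology_of_acyclic`.  So the homotopy-sphere hypothesis is used exactly through
  `b₁ = b₂ = b₃ = 0`.
-/

noncomputable section

-- the prescribed namespace `Summit.<P>.<Sub>.…` duplicates `SmoothPoincare4` (P = Sub)
set_option linter.dupNamespace false

open scoped Manifold ContDiff Topology ContinuousMap
open Set Function CategoryTheory CategoryTheory.Limits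
open Literature.Geometry.Symplectic Literature.AlgebraicTopology.SingularHomology

namespace Summit.SmoothPoincare4.SmoothPoincare4.Theorems.AcyclicBisectionExists.Negative

open Summit.SmoothPoincare4.SmoothPoincare4.Theses.ConvexBisection

/-- Local notation: the model space `ℝ⁴`. -/
local notation "𝔼4" => EuclideanSpace ℝ (Fin 4)
/-- Local notation: the round 4-sphere. -/
local notation "𝕊⁴" => (Metric.sphere (0 : EuclideanSpace ℝ (Fin 5)) 1)

/-! ## §10 The seam is a full ℚ-homology 3-sphere, and the CONVERSE bookkeeping: over a
homotopy 4-sphere, connected halves + seam a ℚHS³ (degrees 1, 2) ⇒ both halves ℚ-acyclic -/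

namespace Witness

open Literature.Topology.FourManifolds

variable {M : Type} [TopologicalSpace M] [ChartedSpace 𝔼4 M] (B : Witness M)
variable [T2Space M] [SecondCountableTopology M] [Nonempty M]

/-- **`dim H₃(∂W₂; ℚ) = 1`** when `W₂` is connected and ℚ-acyclic: `H₄(W₂) = 0 → H₄(W₂, ∂W₂) →
H₃(∂W₂) → H₃(W₂) = 0` and `H₄(W₂, ∂W₂) ≅ H⁰(W₂; ℚ) ≅ ℚ` (Lefschetz).  With `isZero_homology_bd₂`
(degrees 1, 2) and `connectedSpace_bd₁`/`seamHomeomorph` (degree 0) the seam of an acyclic witness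
with connected halves is a ℚ-homology 3-SPHERE, as the crux text asserts informally. [folklore] -/
theorem finrank_homology_bd₂_three [ConnectedSpace B.W₂] (h₂ : B.AcyclicRight) :
    Module.finrank ℚ (singularHomology ℚ ℚ B.Bd₂ 3) = 1 := by
  haveI := B.t2Space₂
  -- `δ : H₄(W₂, ∂W₂) → H₃(∂W₂)` is an isomorphism
  have h4 : IsZero (singularHomology ℚ ℚ B.W₂ 4) := B.isZero_homology₂_of_four_le le_rfl
  haveI : Mono (relativeSingularHomology.δ ℚ ℚ B.W₂ ((𝓡∂ 4).boundary B.W₂) 3) :=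
    (relativeSingularHomology.exact_ofAbsolute_δ ℚ ℚ ((𝓡∂ 4).boundary B.W₂) 3).mono_g
      (h4.eq_of_src _ _)
  haveI : Epi (relativeSingularHomology.δ ℚ ℚ B.W₂ ((𝓡∂ 4).boundary B.W₂) 3) :=
    (relativeSingularHomology.exact_δ_map ℚ ℚ ((𝓡∂ 4).boundary B.W₂) 3).epi_f
      ((h₂ 3 (by norm_num)).eq_of_tgt _ _)
  haveI := isIso_of_mono_of_epi (relativeSingularHomology.δ ℚ ℚ B.W₂ ((𝓡∂ 4).boundary B.W₂) 3)
  have e1 : relativeSingularHomology ℚ ℚ B.W₂ ((𝓡∂ 4).boundary B.W₂) 4 ≃ₗ[ℚ]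
      singularHomology ℚ ℚ B.Bd₂ 3 :=
    (asIso (relativeSingularHomology.δ ℚ ℚ B.W₂ ((𝓡∂ 4).boundary B.W₂) 3)).toLinearEquiv
  rw [← e1.finrank_eq]
  -- Lefschetz: `H⁰(W₂; ℚ) ≃ H₄(W₂, ∂W₂; ℚ)`, and `dim H⁰ = 1`
  obtain ⟨zq, hbij⟩ := B.exists_lefschetz₂ (p := 0) (q := 2 + 1 + 1) rfl
  rw [← (LinearEquiv.ofBijective ((relCapProduct (M := ℚ) ((𝓡∂ (2 + 1 + 1)).boundary B.W₂)
    (show 0 + (2 + 1 + 1) = 2 + 1 + 1 from rfl)).flip zq) hbij).finrank_eq]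
  rw [finrank_singularCohomology_eq_bettiNumber_of_field ℚ B.W₂ 0, bettiNumber]
  haveI : LocallyPathConnectedSpace B.W₂ :=
    ChartedSpace.locallyPathConnectedSpace (EuclideanHalfSpace 4) B.W₂
  haveI : PathConnectedSpace B.W₂ := pathConnectedSpace_iff_connectedSpace.mpr ‹_›
  haveI := singularHomology.isIso_ε_of_pathConnectedSpace ℚ ℚ (X := B.W₂)
  rw [(asIso (singularHomology.ε ℚ ℚ B.W₂)).toLinearEquiv.finrank_eq]
  change Module.finrank ℚ (ULift.{0} ℚ) = 1
  rw [ULift.moduleEquiv.finrank_eq, Module.finrank_self]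

variable [IsManifold (𝓡 4) ∞ M]

/-- One rung of the converse ladder: if `Hₖ(∂W₁; ℚ) = 0`, `Hₖ₊₁(W₁; ℚ) = 0` and
`Hₖ(M; ℚ) = 0` then `Hₖ(W₂; ℚ) = 0` — `Hₖ₊₁(W₁) ↠ Hₖ₊₁(W₁, ∂W₁) ≅ Hₖ₊₁(M, e₂W₂) → Hₖ(e₂W₂) → Hₖ(M)`.
[folklore] -/
theorem isZero_homology₂_of_bd₁ {k : ℕ} (hΓ : IsZero (singularHomology ℚ ℚ B.Bd₁ k))
    (hW₁ : IsZero (singularHomology ℚ ℚ B.W₁ (k + 1))) (hM : IsZero (singularHomology ℚ ℚ M k)) :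
    IsZero (singularHomology ℚ ℚ B.W₂ k) := by
  refine IsZero.of_iso ?_ (singularHomology.mapIso ℚ ℚ B.emb₂.isEmbedding.toHomeomorph k)
  -- `H_{k+1}(W₁, ∂W₁) = 0`
  haveI : Epi (relativeSingularHomology.ofAbsolute ℚ ℚ B.W₁ ((𝓡∂ 4).boundary B.W₁) (k + 1)) :=
    (relativeSingularHomology.exact_ofAbsolute_δ ℚ ℚ ((𝓡∂ 4).boundary B.W₁) k).epi_f
      (hΓ.eq_of_tgt _ _)
  have hrel₁ : IsZero (relativeSingularHomology ℚ ℚ B.W₁ ((𝓡∂ 4).boundary B.W₁) (k + 1)) :=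
    hW₁.of_epi (relativeSingularHomology.ofAbsolute ℚ ℚ B.W₁ ((𝓡∂ 4).boundary B.W₁) (k + 1))
  -- `≅ H_{k+1}(M, e₂W₂)`
  haveI := B.swap.isIso_relMap₂ ℚ ℚ (k + 1)
  have hrel : IsZero (relativeSingularHomology ℚ ℚ M (range B.e₂) (k + 1)) :=
    hrel₁.of_iso (asIso (relativeSingularHomology.map ℚ ℚ B.swap.e₂CM
      B.swap.mapsTo_e₂_boundary (k + 1))).symm
  exact (relativeSingularHomology.exact_δ_map ℚ ℚ (range B.e₂) k).isZero_of_both_zeros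
    (hrel.eq_of_src _ _) (hM.eq_of_tgt _ _)

/-- **Converse bookkeeping.**  Over an `M` with the ℚ-homology of `S⁴` (degrees 1–4), a witness
with CONNECTED halves whose seam is a ℚ-homology sphere in degrees 1 and 2 has both halves
ℚ-acyclic: degree 3 by the dimension count of §8 (no acyclicity needed there), then degrees 2 and
1 alternately on the two halves by `isZero_homology₂_of_bd₁`, degrees `≥ 4` by the external
collar. [folklore] -/
theorem acyclic_of_seam [ConnectedSpace B.W₁] [ConnectedSpace B.W₂]
    (hΓ₁ : IsZero (singularHomology ℚ ℚ B.Bd₁ 1)) (hΓ₂ : IsZero (singularHomology ℚ ℚ B.Bd₁ 2))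
    (hM : ∀ k, 0 < k → k ≤ 3 → IsZero (singularHomology ℚ ℚ M k))
    (hM4 : Module.finrank ℚ (singularHomology ℚ ℚ M 4) = 1) : B.Acyclic := by
  -- the seam homology seen from `W₂`
  have hΓ₁' : IsZero (singularHomology ℚ ℚ B.Bd₂ 1) := hΓ₁.of_iso (singularHomology.mapIso ℚ ℚ B.seamHomeomorph 1).symm
  have hΓ₂' : IsZero (singularHomology ℚ ℚ B.Bd₂ 2) := hΓ₂.of_iso (singularHomology.mapIso ℚ ℚ B.seamHomeomorph 2).symm
  -- degree 3
  have h3₂ : IsZero (singularHomology ℚ ℚ B.W₂ 3) := B.isZero_homology₂_three (hM 3 (by norm_num) le_rfl) hM4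
  have h3₁ : IsZero (singularHomology ℚ ℚ B.W₁ 3) :=
    B.swap.isZero_homology₂_three (hM 3 (by norm_num) le_rfl) hM4
  -- degree 2, then degree 1
  have h2₂ : IsZero (singularHomology ℚ ℚ B.W₂ 2) := B.isZero_homology₂_of_bd₁ hΓ₂ h3₁ (hM 2 (by norm_num) (by norm_num))
  have h2₁ : IsZero (singularHomology ℚ ℚ B.W₁ 2) :=
    B.swap.isZero_homology₂_of_bd₁ hΓ₂' h3₂ (hM 2 (by norm_num) (by norm_num))
  have h1₂ : IsZero (singularHomology ℚ ℚ B.W₂ 1) := B.isZero_homology₂_of_bd₁ hΓ₁ h2₁ (hM 1 (by norm_num) (by norm_num))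
  have h1₁ : IsZero (singularHomology ℚ ℚ B.W₁ 1) :=
    B.swap.isZero_homology₂_of_bd₁ hΓ₁' h2₂ (hM 1 (by norm_num) (by norm_num))
  intro k hk
  rcases Nat.lt_or_ge k 4 with h | h
  · interval_cases k
    · exact ⟨h1₁, h1₂⟩
    · exact ⟨h2₁, h2₂⟩
    · exact ⟨h3₁, h3₂⟩
  · exact ⟨B.swap.isZero_homology₂_of_four_le h, B.isZero_homology₂_of_four_le h⟩

/-- **In the crux's setting**: over `M ≃ₕ S⁴`, a Stein bisection along a common contact seam
with connected halves is ℚ-acyclic iff its seam is a ℚ-homology sphere in degrees 1 and 2 — the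
informal gloss "(⇔ seam a connected ℚHS³)" of the crux text, machine-checked in both directions
(⇒: `isZero_homology_bd₁`; ⇐: `acyclic_of_seam`). [folklore] -/
theorem acyclic_iff_seam_of_homotopyEquiv (e : M ≃ₕ 𝕊⁴) [ConnectedSpace B.W₁] [ConnectedSpace B.W₂] :
    B.Acyclic ↔ IsZero (singularHomology ℚ ℚ B.Bd₁ 1) ∧ IsZero (singularHomology ℚ ℚ B.Bd₁ 2) :=
  ⟨fun hB => ⟨B.isZero_homology_bd₁ hB.left (by norm_num) (by norm_num),
      B.isZero_homology_bd₁ hB.left (by norm_num) (by norm_num)⟩,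
    fun h => B.acyclic_of_seam h.1 h.2
      (fun k hk hk3 => isZero_homology_of_homotopyEquiv_sphere e (by omega) (by omega))
      (finrank_homology_four_of_homotopyEquiv_sphere e)⟩

end Witness

/-! ## §7 The near-miss of gen 1, now CLOSED: the homotopy-sphere hypothesis cannot be weakened
to "closed simply connected" -/

open Literature.Topology.FourManifolds in
/-- **`ℂℙ²` has no ℚ-acyclic Stein bisection** (along a common contact seam or not — the contact
condition is not used): `H₂(ℂℙ²; ℚ) ≅ ℚ ≠ 0` (tree `ComplexProjectivePlane.singularHomologyTwoIso`)
against `Witness.isZero_homology_of_acyclic`.  Hence the homotopy-sphere hypothesis of the crux is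
used at least through `b₂(M) = 0` (and `b₁ = b₃ = 0`), not merely through compactness or simple
connectivity. [folklore] -/
theorem not_hasAcyclicSteinBisection_complexProjectivePlane :
    ¬ HasAcyclicSteinBisection ComplexProjectivePlane := by
  rintro ⟨B, hB⟩
  have h2 := B.isZero_homology_of_acyclic hB (k := 2) (by norm_num) (by norm_num)
  have hQ : IsZero (ModuleCat.of ℚ ℚ) :=
    h2.of_iso (ComplexProjectivePlane.singularHomologyTwoIso ℚ ℚ).symm
  haveI := ModuleCat.subsingleton_of_isZero hQ
  exact zero_ne_one (Subsingleton.elim (0 : ℚ) 1)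

/-- **Refuted weakening**: NOT every closed (compact, connected) simply connected smooth
4-manifold admits a ℚ-acyclic Stein bisection along a common contact seam — witness `ℂℙ²`; so the
hypothesis `M ≃ₕ S⁴` of the crux cannot be weakened to "closed simply connected". [folklore] -/
theorem not_acyclicBisectionExistsForSimplyConnectedClosed :
    ¬ ∀ (M : Type) [TopologicalSpace M] [T2Space M] [SecondCountableTopology M] [CompactSpace M]
      [ConnectedSpace M] [SimplyConnectedSpace M] [ChartedSpace 𝔼4 M] [IsManifold (𝓡 4) ∞ M],
      HasAcyclicSteinBisection M := fun h =>
  not_hasAcyclicSteinBisection_complexProjectivePlane (h Literature.Topology.FourManifolds.ComplexProjectivePlane)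

end Summit.SmoothPoincare4.SmoothPoincare4.Theorems.AcyclicBisectionExists.Negative
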